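import Literature.Topology.FourManifolds.OpenTrace
import Literature.Topology.FourManifolds.SphereSimplyConnected
import Literature.AlgebraicTopology.FundamentalGroupoid.SimplyConnectedComplPoint
import HarnessLib

/-!
# The open trace of a framed knot is simply connected, and so is its punctured form

Topic `Literature/Topology/FourManifolds`; groundwork for the fact item
`provefact-Literature.Topology.FourManifolds.Knot.M-9195998579`, the named fact
`Literature.Topology.FourManifolds.Knot.ManolescuPiccirillo2023_lemma33_sphere_core`
(`ZeroSurgeryHomotopyBallSliceProofs.lean`: Manolescu–Piccirillo (2023), proof of Lemma 3.3 for
`W = S⁴` — the glued manifold `X = X(K') ∪_Y V` is simply connected with `H₂(X; ℤ) = 0`).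

The open trace `T = TubeNbhd.OpenTrace ν` of a framed circle (`OpenTrace.lean`: the `0`-handle chart
`ℝ⁴` glued to the `2`-handle chart `ℝ² × ℝ²` along `x ≠ 0`) enters the computation of `π₁(X)` and
`H₂(X)` through two elementary facts proved here by the easy half of van Kampen's theorem
(Hatcher, *Algebraic Topology* (2002), Lemma 1.15, in the tree as
`Literature.Topology.FourManifolds.simplyConnectedSpace_of_isOpen_union`):

* `TubeNbhd.simplyConnectedSpace_openTrace`: **`T` is simply connected** — both charts are
  contractible and they meet in `inr({x ≠ 0}) ≅ (ℝ² ∖ 0) × ℝ²`, which is path connected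
  (MP: "`X(K')` … is simply connected"; `π₁(B⁴ ∪ h²) = 1`).
* `TubeNbhd.isSimplyConnected_compl_image_closedBall`: **the punctured open trace
  `T° = T ∖ inl(B̄⁴)` is simply connected** — it is covered by `inl(ℝ⁴ ∖ B̄⁴) ≃ S³` (simply
  connected: `ℝ⁴ ∖ B̄⁴ ≅ ℝ⁴ ∖ 0`, and removing a point from `ℝⁿ`, `n ≥ 3`, keeps it simply connected,
  `Literature.AlgebraicTopology.FundamentalGroupoid.isSimplyConnected_compl_singleton_of_isOpenEmbedding`)
  and the open `2`-handle `inr(B̊² × ℝ²)` (convex), meeting in `inr((B̊² ∖ 0) × ℝ²)` (path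
  connected). Topologically `T° ≃ S³ ∪_{K} e²`; in the Manolescu–Piccirillo gluing its image is the
  "upside down" picture of `X ∖ B̊⁴` on the trace side, and `π₁(T°) = 1` is what makes
  `H₁` of the collar `T ∖ C` cyclic, generated by the meridian of the core disc.

Also recorded: the set-theoretic descriptions of `T°` and of the overlap of its two pieces
(`compl_image_closedBall_eq`, `image_compl_closedBall_inter_image_ball_prod`), and two reusable
elementary lemmas (`isSimplyConnected_union_of_isOpen`, the set form of Hatcher's Lemma 1.15, and
`isSimplyConnected_compl_closedBall`, `ℝⁿ ∖ B̄ⁿ` is simply connected for `n ≥ 3`).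

## References

* A. Hatcher, *Algebraic Topology*, CUP (2002), §1.2 Lemma 1.15, Prop. 1.14. [HatcherAT2002]
* C. Manolescu, L. Piccirillo, *From zero surgeries to candidates for exotic definite
  4-manifolds*, J. Lond. Math. Soc. (2) 108 (2023), §3.2, proof of Lemma 3.3. [ManolescuPiccirillo2023]
* R. C. Kirby, *The Topology of 4-Manifolds*, LNM 1374 (1989), Ch. I §§1–2. [Kirby1989]

## Design notes

* No definitions: `T°` is written `(inl '' closedBall 0 1)ᶜ` throughout; everything is a theorem.
* No declaration in this file uses `sorry`; no named facts are introduced.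
-/

noncomputable section

open Set Function Metric Module
open scoped Manifold ContDiff Topology

namespace Literature.Topology.FourManifolds

/-! ### Elementary lemmas: unions, punctured balls, the exterior of a ball -/

section Elementary

variable {X : Type*} [TopologicalSpace X]

/-- **Hatcher's Lemma 1.15, set form**: the union of two open simply connected subsets with path
connected intersection is simply connected. [cite: HatcherAT2002, Lemma 1.15] -/
theorem isSimplyConnected_union_of_isOpen {A B : Set X} (hA : IsOpen A) (hB : IsOpen B)
    (hAsc : IsSimplyConnected A) (hBsc : IsSimplyConnected B) (hAB : IsPathConnected (A ∩ B)) :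
    IsSimplyConnected (A ∪ B) := by
  have hval : Topology.IsEmbedding (Subtype.val : ↥(A ∪ B) → X) := Topology.IsEmbedding.subtypeVal
  have hA' : IsSimplyConnected ((Subtype.val : ↥(A ∪ B) → X) ⁻¹' A) := by
    rw [← hval.isSimplyConnected_image, Subtype.image_preimage_coe,
      inter_eq_right.2 subset_union_left]
    exact hAsc
  have hB' : IsSimplyConnected ((Subtype.val : ↥(A ∪ B) → X) ⁻¹' B) := by
    rw [← hval.isSimplyConnected_image, Subtype.image_preimage_coe,
      inter_eq_right.2 subset_union_right]
    exact hBsc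
  have hAB' : IsPathConnected ((Subtype.val : ↥(A ∪ B) → X) ⁻¹' A ∩ Subtype.val ⁻¹' B) := by
    rw [← preimage_inter, hval.isInducing.isPathConnected_iff, Subtype.image_preimage_coe,
      inter_eq_right.2 (inter_subset_left.trans subset_union_left)]
    exact hAB
  have hcov : (Subtype.val : ↥(A ∪ B) → X) ⁻¹' A ∪ Subtype.val ⁻¹' B = univ := by
    ext ⟨x, hx⟩
    simpa using hx
  exact simplyConnectedSpace_of_isOpen_union (hA.preimage continuous_subtype_val)
    (hB.preimage continuous_subtype_val) hcov hA' hB' hAB'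

variable {E : Type*} [NormedAddCommGroup E] [NormedSpace ℝ E]

/-- The punctured open ball `B(0, r) ∖ {0}` of a real normed space of dimension `≥ 2` is path
connected: it is the image of `S(0,1) × (0, r)` under `(u, t) ↦ t • u`. [folklore] -/
theorem isPathConnected_ball_diff_zero_of_one_lt_rank (h : 1 < Module.rank ℝ E) {r : ℝ} (hr : 0 < r) :
    IsPathConnected (ball (0 : E) r \ {0}) := by
  have heq : ball (0 : E) r \ {0} = (fun p : E × ℝ ↦ p.2 • p.1) '' (sphere (0 : E) 1 ×ˢ Ioo 0 r) := by
    ext x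
    simp only [mem_sdiff, mem_ball, dist_zero_right, mem_singleton_iff, mem_image, mem_prod,
      mem_sphere_iff_norm, sub_zero, mem_Ioo, Prod.exists]
    constructor
    · rintro ⟨hxr, hx0⟩
      have hpos : 0 < ‖x‖ := norm_pos_iff.2 hx0
      refine ⟨‖x‖⁻¹ • x, ‖x‖, ⟨by rw [norm_smul, norm_inv, norm_norm, inv_mul_cancel₀ hpos.ne'],
        hpos, hxr⟩, ?_⟩
      rw [smul_smul, mul_inv_cancel₀ hpos.ne', one_smul]
    · rintro ⟨u, t, ⟨hu, ht0, htr⟩, rfl⟩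
      rw [norm_smul, Real.norm_of_nonneg ht0.le, hu, mul_one]
      exact ⟨htr, smul_ne_zero ht0.ne' (by rintro rfl; simp at hu)⟩
  rw [heq]
  exact ((isPathConnected_sphere h 0 zero_le_one).prod
    ((convex_Ioo 0 r).isPathConnected (nonempty_Ioo.2 hr))).image (continuous_snd.smul continuous_fst)

/-- **The exterior of a closed ball in `ℝⁿ`, `n ≥ 3`, is simply connected**: it is homeomorphic to
`ℝⁿ ∖ {0}` by the radial shift `y ↦ (1 + r/‖y‖) y`, and removing a point from `ℝⁿ` with `n ≥ 3`
keeps it simply connected (Hatcher (2002), Prop. 1.14: `ℝⁿ ∖ 0 ≃ Sⁿ⁻¹`). [cite: HatcherAT2002, Prop. 1.14] -/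
theorem isSimplyConnected_compl_closedBall [FiniteDimensional ℝ E] (h3 : 2 < finrank ℝ E)
    {r : ℝ} (hr : 0 ≤ r) : IsSimplyConnected ((closedBall (0 : E) r)ᶜ) := by
  -- `ℝⁿ ∖ {0}` is simply connected
  have h0 : IsSimplyConnected ({(0 : E)}ᶜ : Set E) := by
    have := Literature.AlgebraicTopology.FundamentalGroupoid.isSimplyConnected_compl_singleton_of_isOpenEmbedding
      (M := E) (i := (id : E → E)) Topology.IsOpenEmbedding.id h3
    simpa using this
  haveI : SimplyConnectedSpace ↥({(0 : E)}ᶜ : Set E) := h0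
  -- the radial shift and its inverse
  have hmem₁ : ∀ y : ↥({(0 : E)}ᶜ : Set E), (1 + r * ‖(y : E)‖⁻¹) • (y : E) ∈ (closedBall (0 : E) r)ᶜ := by
    rintro ⟨y, hy⟩
    have hy0 : y ≠ 0 := hy
    have hpos : 0 < ‖y‖ := norm_pos_iff.2 hy0
    simp only [mem_compl_iff, mem_closedBall, dist_zero_right, not_le, norm_smul]
    rw [Real.norm_of_nonneg (by positivity), add_mul, one_mul, mul_assoc, inv_mul_cancel₀ hpos.ne',
      mul_one]
    linarith
  have hmem₂ : ∀ z : ↥((closedBall (0 : E) r)ᶜ), (1 - r * ‖(z : E)‖⁻¹) • (z : E) ∈ ({(0 : E)}ᶜ : Set E) := by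
    rintro ⟨z, hz⟩
    simp only [mem_compl_iff, mem_closedBall, dist_zero_right, not_le] at hz
    have hpos : 0 < ‖z‖ := hr.trans_lt hz
    simp only [mem_compl_iff, mem_singleton_iff, smul_eq_zero, not_or]
    refine ⟨sub_ne_zero.2 ?_, by rintro rfl; simp at hpos⟩
    have hlt : r * ‖z‖⁻¹ < 1 := by rw [mul_inv_lt_iff₀ hpos, one_mul]; exact hz
    exact hlt.ne'
  let φ : ↥({(0 : E)}ᶜ : Set E) ≃ₜ ↥((closedBall (0 : E) r)ᶜ) :=
    { toFun := fun y ↦ ⟨_, hmem₁ y⟩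
      invFun := fun z ↦ ⟨_, hmem₂ z⟩
      left_inv := by
        rintro ⟨y, hy⟩
        have hy0 : y ≠ 0 := hy
        have hpos : 0 < ‖y‖ := norm_pos_iff.2 hy0
        ext1
        simp only [norm_smul, smul_smul]
        rw [Real.norm_of_nonneg (by positivity)]
        have h1 : (1 + r * ‖y‖⁻¹) * ‖y‖ = ‖y‖ + r := by field_simp
        rw [h1]
        have h2 : (1 - r * (‖y‖ + r)⁻¹) * (1 + r * ‖y‖⁻¹) = 1 := by
          field_simp
          ring
        rw [h2, one_smul]
      right_inv := by
        rintro ⟨z, hz⟩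
        simp only [mem_compl_iff, mem_closedBall, dist_zero_right, not_le] at hz
        have hpos : 0 < ‖z‖ := hr.trans_lt hz
        have hzr : 0 < ‖z‖ - r := sub_pos.2 hz
        ext1
        simp only [norm_smul, smul_smul]
        have h1 : ‖1 - r * ‖z‖⁻¹‖ * ‖z‖ = ‖z‖ - r := by
          rw [Real.norm_of_nonneg, sub_mul, one_mul, mul_assoc, inv_mul_cancel₀ hpos.ne', mul_one]
          rw [sub_nonneg, mul_inv_le_iff₀ hpos, one_mul]
          exact hz.le
        rw [h1]
        have h2 : (1 + r * (‖z‖ - r)⁻¹) * (1 - r * ‖z‖⁻¹) = 1 := by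
          field_simp
          ring
        rw [h2, one_smul]
      continuous_toFun := by
        refine Continuous.subtype_mk (Continuous.smul ?_ continuous_subtype_val) _
        exact continuous_const.add (continuous_const.mul
          ((continuous_subtype_val.norm).inv₀ fun y ↦ (norm_pos_iff.2 y.2).ne'))
      continuous_invFun := by
        refine Continuous.subtype_mk (Continuous.smul ?_ continuous_subtype_val) _
        refine continuous_const.sub (continuous_const.mul ((continuous_subtype_val.norm).inv₀ ?_))
        rintro ⟨z, hz⟩
        simp only [mem_compl_iff, mem_closedBall, dist_zero_right, not_le] at hz
        exact (hr.trans_lt hz).ne' }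
  exact φ.symm.toHomotopyEquiv.simplyConnectedSpace

end Elementary

/-! ### The open trace -/

namespace TubeNbhd

variable {c : Metric.sphere (0 : EuclideanSpace ℝ (Fin 2)) 1 → Metric.sphere (0 : EuclideanSpace ℝ (Fin 4)) 1} (ν : TubeNbhd (𝓡 3) c)

/-- The gluing region of the open trace seen from both charts: `inl(ℝ⁴) ∩ inr(ℝ² × ℝ²) = inr({x ≠ 0})`.
[folklore] -/
theorem range_inl_inter_range_inr :
    range ν.traceGlueData.inl ∩ range ν.traceGlueData.inr =
      ν.traceGlueData.inr '' {p : (EuclideanSpace ℝ (Fin 2)) × (EuclideanSpace ℝ (Fin 2)) | p.1 ≠ 0} := by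
  ext z
  constructor
  · rintro ⟨hl, ⟨p, rfl⟩⟩
    exact ⟨p, ν.inr_mem_range_inl_iff.1 hl, rfl⟩
  · rintro ⟨p, hp, rfl⟩
    exact ⟨ν.inr_mem_range_inl_iff.2 hp, p, rfl⟩

/-- `{p : ℝ² × ℝ² | p.1 ≠ 0} = (ℝ² ∖ 0) × ℝ²` is path connected. [folklore] -/
theorem isPathConnected_setOf_fst_ne_zero :
    IsPathConnected {p : (EuclideanSpace ℝ (Fin 2)) × (EuclideanSpace ℝ (Fin 2)) | p.1 ≠ 0} := by
  have heq : {p : (EuclideanSpace ℝ (Fin 2)) × (EuclideanSpace ℝ (Fin 2)) | p.1 ≠ 0} = ({(0 : EuclideanSpace ℝ (Fin 2))}ᶜ : Set (EuclideanSpace ℝ (Fin 2))) ×ˢ (univ : Set (EuclideanSpace ℝ (Fin 2))) := by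
    ext p
    simp
  have hrank : 1 < Module.rank ℝ (EuclideanSpace ℝ (Fin 2)) := by
    rw [← Module.finrank_eq_rank, finrank_euclideanSpace, Fintype.card_fin]
    norm_num
  rw [heq]
  exact (isPathConnected_compl_singleton_of_one_lt_rank hrank 0).prod isPathConnected_univ

/-- **The open trace is simply connected**: `T = inl(ℝ⁴) ∪ inr(ℝ² × ℝ²)` with both charts
contractible and path connected overlap `inr((ℝ² ∖ 0) × ℝ²)` (Hatcher (2002), Lemma 1.15). This is
`π₁(X(K)) = 1` for the trace of a knot (a `4`-ball with one `2`-handle).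
[cite: HatcherAT2002, Lemma 1.15] -/
theorem simplyConnectedSpace_openTrace : SimplyConnectedSpace ν.OpenTrace := by
  refine simplyConnectedSpace_of_isOpen_union ν.traceGlueData.isOpen_range_inl
    ν.traceGlueData.isOpen_range_inr ν.traceGlueData.range_inl_union_range_inr ?_ ?_ ?_
  · rw [← image_univ, ν.traceGlueData.isOpenEmbedding_inl.isEmbedding.isSimplyConnected_image]
    exact (Homeomorph.Set.univ (EuclideanSpace ℝ (Fin 4))).toHomotopyEquiv.simplyConnectedSpace
  · rw [← image_univ, ν.traceGlueData.isOpenEmbedding_inr.isEmbedding.isSimplyConnected_image]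
    exact (Homeomorph.Set.univ ((EuclideanSpace ℝ (Fin 2)) × (EuclideanSpace ℝ (Fin 2)))).toHomotopyEquiv.simplyConnectedSpace
  · rw [ν.range_inl_inter_range_inr]
    exact isPathConnected_setOf_fst_ne_zero.image ν.traceGlueData.continuous_inr

/-- In particular the open trace is path connected. [folklore] -/
theorem pathConnectedSpace_openTrace : PathConnectedSpace ν.OpenTrace := by
  haveI := ν.simplyConnectedSpace_openTrace
  infer_instance

/-! ### The punctured open trace `T° = T ∖ inl(B̄⁴)` -/

/-- A point `inr (x, w)` of the `2`-handle chart lies in the `0`-handle `inl(B̄⁴)` iff `‖x‖ ≥ 1`.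
[folklore] -/
theorem inr_mem_image_closedBall_iff {x w : EuclideanSpace ℝ (Fin 2)} :
    ν.traceGlueData.inr (x, w) ∈ ν.traceGlueData.inl '' closedBall (0 : EuclideanSpace ℝ (Fin 4)) 1 ↔ 1 ≤ ‖x‖ := by
  constructor
  · rintro ⟨y, hy, hxy⟩
    have hmem : ν.traceGlueData.inr (x, w) ∈ range ν.traceGlueData.inl := ⟨y, hxy⟩
    rw [ν.inr_mem_range_inl_iff] at hmem
    obtain ⟨-, h⟩ := ν.inl_eq_inr_iff.1 hxy
    subst h
    rw [mem_closedBall, dist_zero_right, ν.norm_traceBwd] at hy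
    exact (inv_le_one₀ (norm_pos_iff.2 hmem)).1 hy
  · intro hx
    have hx0 : x ≠ 0 := by
      rintro rfl
      norm_num at hx
    refine ⟨ν.traceBwd (x, w), ?_, ν.inl_eq_inr_iff.2 ⟨hx0, rfl⟩⟩
    rw [mem_closedBall, dist_zero_right, ν.norm_traceBwd]
    exact inv_le_one_of_one_le₀ hx

/-- A point `inl y` lies in the `0`-handle `inl(B̄⁴)` iff `‖y‖ ≤ 1`. [folklore] -/
theorem inl_mem_image_closedBall_iff {y : EuclideanSpace ℝ (Fin 4)} :
    ν.traceGlueData.inl y ∈ ν.traceGlueData.inl '' closedBall (0 : EuclideanSpace ℝ (Fin 4)) 1 ↔ ‖y‖ ≤ 1 := by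
  rw [ν.traceGlueData.inl_injective.mem_set_image, mem_closedBall, dist_zero_right]

/-- **The punctured open trace from the two charts**:
`T ∖ inl(B̄⁴) = inl(ℝ⁴ ∖ B̄⁴) ∪ inr(B̊² × ℝ²)`. [folklore] -/
theorem compl_image_closedBall_eq :
    (ν.traceGlueData.inl '' closedBall (0 : EuclideanSpace ℝ (Fin 4)) 1)ᶜ =
      ν.traceGlueData.inl '' (closedBall (0 : EuclideanSpace ℝ (Fin 4)) 1)ᶜ ∪
        ν.traceGlueData.inr '' (ball (0 : EuclideanSpace ℝ (Fin 2)) 1 ×ˢ (univ : Set (EuclideanSpace ℝ (Fin 2)))) := by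
  ext z
  simp only [mem_compl_iff, mem_union]
  constructor
  · intro hz
    obtain (⟨y, rfl⟩ | ⟨⟨x, w⟩, rfl⟩) := ν.traceGlueData.exists_inl_or_inr z
    · refine Or.inl ⟨y, ?_, rfl⟩
      rw [ν.inl_mem_image_closedBall_iff] at hz
      simpa using hz
    · refine Or.inr ⟨(x, w), ⟨?_, mem_univ _⟩, rfl⟩
      rw [ν.inr_mem_image_closedBall_iff, not_le] at hz
      simpa using hz
  · rintro (⟨y, hy, rfl⟩ | ⟨⟨x, w⟩, ⟨hx, -⟩, rfl⟩)
    · rw [ν.inl_mem_image_closedBall_iff]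
      simpa using hy
    · rw [ν.inr_mem_image_closedBall_iff, not_le]
      simpa using hx

/-- The overlap of the two pieces of the punctured open trace:
`inl(ℝ⁴ ∖ B̄⁴) ∩ inr(B̊² × ℝ²) = inr((B̊² ∖ 0) × ℝ²)`. [folklore] -/
theorem image_compl_closedBall_inter_image_ball_prod :
    ν.traceGlueData.inl '' (closedBall (0 : EuclideanSpace ℝ (Fin 4)) 1)ᶜ ∩
        ν.traceGlueData.inr '' (ball (0 : EuclideanSpace ℝ (Fin 2)) 1 ×ˢ (univ : Set (EuclideanSpace ℝ (Fin 2)))) =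
      ν.traceGlueData.inr '' ((ball (0 : EuclideanSpace ℝ (Fin 2)) 1 \ {0}) ×ˢ (univ : Set (EuclideanSpace ℝ (Fin 2)))) := by
  ext z
  constructor
  · rintro ⟨⟨y, hy, hyz⟩, ⟨⟨x, w⟩, ⟨hx, -⟩, rfl⟩⟩
    have hmem : ν.traceGlueData.inr (x, w) ∈ range ν.traceGlueData.inl := ⟨y, hyz⟩
    rw [ν.inr_mem_range_inl_iff] at hmem
    exact ⟨(x, w), ⟨⟨hx, hmem⟩, mem_univ _⟩, rfl⟩
  · rintro ⟨⟨x, w⟩, ⟨⟨hx, hx0⟩, -⟩, rfl⟩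
    have hx0' : x ≠ 0 := hx0
    refine ⟨⟨ν.traceBwd (x, w), ?_, ν.inl_eq_inr_iff.2 ⟨hx0', rfl⟩⟩, ⟨(x, w), ⟨hx, mem_univ _⟩, rfl⟩⟩
    rw [mem_ball, dist_zero_right] at hx
    rw [mem_compl_iff, mem_closedBall, dist_zero_right, ν.norm_traceBwd, not_le]
    exact (one_lt_inv₀ (norm_pos_iff.2 hx0')).2 hx

/-- The punctured open trace is open. [folklore] -/
theorem isOpen_compl_image_closedBall :
    IsOpen (ν.traceGlueData.inl '' closedBall (0 : EuclideanSpace ℝ (Fin 4)) 1)ᶜ :=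
  ((isCompact_closedBall (0 : EuclideanSpace ℝ (Fin 4)) 1).image ν.traceGlueData.continuous_inl).isClosed.isOpen_compl

/-- **The punctured open trace `T° = T ∖ inl(B̄⁴)` is simply connected**: it is the union of
`inl(ℝ⁴ ∖ B̄⁴)` (simply connected, `≃ S³`) and the open `2`-handle `inr(B̊² × ℝ²)` (convex), which
meet in the path connected `inr((B̊² ∖ 0) × ℝ²)` (Hatcher (2002), Lemma 1.15). Topologically
`T° ≃ S³ ∪_K e²`. [cite: HatcherAT2002, Lemma 1.15] -/
theorem isSimplyConnected_compl_image_closedBall :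
    IsSimplyConnected (ν.traceGlueData.inl '' closedBall (0 : EuclideanSpace ℝ (Fin 4)) 1)ᶜ := by
  rw [ν.compl_image_closedBall_eq]
  have hrank2 : 1 < Module.rank ℝ (EuclideanSpace ℝ (Fin 2)) := by
    rw [← Module.finrank_eq_rank, finrank_euclideanSpace, Fintype.card_fin]
    norm_num
  refine isSimplyConnected_union_of_isOpen
    (ν.traceGlueData.isOpenMap_inl _ isClosed_closedBall.isOpen_compl)
    (ν.traceGlueData.isOpenMap_inr _ (isOpen_ball.prod isOpen_univ)) ?_ ?_ ?_
  · rw [ν.traceGlueData.isOpenEmbedding_inl.isEmbedding.isSimplyConnected_image]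
    refine isSimplyConnected_compl_closedBall ?_ zero_le_one
    rw [finrank_euclideanSpace, Fintype.card_fin]
    norm_num
  · rw [ν.traceGlueData.isOpenEmbedding_inr.isEmbedding.isSimplyConnected_image]
    have hconv : Convex ℝ (ball (0 : EuclideanSpace ℝ (Fin 2)) 1 ×ˢ (univ : Set (EuclideanSpace ℝ (Fin 2)))) :=
      (convex_ball 0 1).prod convex_univ
    haveI := hconv.contractibleSpace ⟨(0, 0), by simp⟩
    exact (inferInstance : SimplyConnectedSpace ↥(ball (0 : EuclideanSpace ℝ (Fin 2)) 1 ×ˢ (univ : Set (EuclideanSpace ℝ (Fin 2)))))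
  · rw [ν.image_compl_closedBall_inter_image_ball_prod]
    exact ((isPathConnected_ball_diff_zero_of_one_lt_rank hrank2 one_pos).prod isPathConnected_univ).image
      ν.traceGlueData.continuous_inr

end TubeNbhd

end Literature.Topology.FourManifolds
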